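import Literature.Geometry.DiscreteGeometry.EnergyLinearProgrammingBound

/-!
# The cross-polytope bound: `N = 2n` points on `S^{n-1}` and any potential with a quadratic Hermite minorant

Framing: lottery ticket; floor = certified bounds/negative ranges. Venture `PackingBounds` (cell
`pub-packcert`, seat `pub-packcert-energy`), energy-minimisation family, **universal + control**
(every dimension `n ≥ 3`, a whole class of potentials).

**Theorem.** Let `n ≥ 3` and let `a : ℝ → ℝ` be a potential of the inner product. Put
`κ = a(-1) - a(0) + m` for a slope `m ≥ 0` and suppose `κ ≥ 0`, `a(0) + κ/n ≥ 0`, and that the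
quadratic `q(t) = a(0) + m t + κ t²` — the Hermite interpolant of `a` at the nodes `-1` (simple)
and `0` (double, slope `m`) — satisfies `q(t) ≤ a(t)` for `-1 ≤ t < 1`. Then every configuration
of `2n` unit vectors `C ⊂ ℝⁿ` has
`Σ_{x ≠ y ∈ C} a(⟨x, y⟩) ≥ 2n (2(n-1) a(0) + a(-1))`,
the energy of the regular cross-polytope (`2n - 2` orthogonal neighbours and one antipode per
point). For an absolutely monotone `a` (all derivatives `≥ 0` on `[-1,1)`) the hypotheses hold
with `m = a'(0)`: `κ = a(-1) - a(0) + a'(0) ≥ 0` by convexity, and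
`a(t) - q(t) = (t+1) t² · a[-1,0,0,t] ≥ 0` by the Hermite error formula (third divided differences of
`a` are `≥ 0`); this is the universal optimality of the cross-polytope (Cohn–Kumar 2007, Thm. 1.2,
Table 1) in the form delivered by the LP bound with the degree-`2` certificate
`q = (a(0) + κ/n) C_0 + (m/(n-2)) C_1^{(μ)} + (κ/(2μ(μ+1))) C_2^{(μ)}`, `μ = (n-2)/2`
(`C_1^{(μ)} = 2μ t`, `C_2^{(μ)} = 2μ(μ+1) t² - μ`). The divided-difference step is NOT formalised
here: the minorant property is a hypothesis.

## References
* H. Cohn, A. Kumar, J. Amer. Math. Soc. 20 (2007) 99–148, Thm. 1.2, Prop. 4.1, §5. [`CohnKumar2006`]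
-/

namespace Summit.Ventures.PackingBounds.Energy

open Finset Literature.Analysis.SpecialFunctions Literature.Geometry.DiscreteGeometry

/-- `C_2^{(μ)}(t) = 2 μ (μ + 1) t² - μ` for the explicit Gegenbauer sum of the tree. [folklore] -/
theorem gegenbauerSum_two (μ t : ℝ) : gegenbauerSum μ 2 t = 2 * μ * (μ + 1) * t ^ 2 - μ := by
  simp [gegenbauerSum, gegenbauerCoeff, Finset.sum_range_succ, Finset.prod_range_succ,
    Nat.factorial]
  ring

open scoped Classical in
/-- **Universal lower bound attained by the regular cross-polytope.** For `n ≥ 3`, `m ≥ 0`,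
`κ = a(-1) - a(0) + m ≥ 0`, `a(0) + κ/n ≥ 0` and `a(0) + m t + κ t² ≤ a(t)` on `[-1,1)`, every set
of `2n` unit vectors of `ℝⁿ` has `Σ_{x ≠ y} a(⟨x,y⟩) ≥ 2n (2(n-1) a(0) + a(-1))` (sharp for the
cross-polytope). Degree-two LP certificate. [cite: CohnKumar2006, Theorem 1.2 and Proposition 4.1] -/
theorem crossPolytope_energy_ge {n : ℕ} (hn : 3 ≤ n) (a : ℝ → ℝ) (m : ℝ) (hm : 0 ≤ m)
    (hκ : 0 ≤ a (-1) - a 0 + m) (ha0 : 0 ≤ a 0 + (a (-1) - a 0 + m) / n)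
    (hmin : ∀ t : ℝ, -1 ≤ t → t < 1 → a 0 + m * t + (a (-1) - a 0 + m) * t ^ 2 ≤ a t)
    (C : Finset (EuclideanSpace ℝ (Fin n))) (h1 : ∀ x ∈ C, ‖x‖ = 1) (hN : C.card = 2 * n) :
    2 * (n : ℝ) * (2 * ((n : ℝ) - 1) * a 0 + a (-1)) ≤
      ∑ x ∈ C, ∑ y ∈ C.erase x, a (inner ℝ x y) := by
  have hn3 : (3 : ℝ) ≤ n := by exact_mod_cast hn
  set κ : ℝ := a (-1) - a 0 + m with hκdef
  set μ : ℝ := ((n : ℝ) - 2) / 2 with hμdef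
  have hμ : 0 < μ := by rw [hμdef]; linarith
  have hnμ : (n : ℝ) = 2 * μ + 2 := by rw [hμdef]; ring
  have hμ1 : 0 < μ + 1 := by linarith
  have h2μ1 : (0 : ℝ) < 2 * μ + 2 := by linarith
  set α : ℕ → ℝ := fun k => if k = 0 then a 0 + κ / (2 * μ + 2) else if k = 1 then m / (2 * μ)
    else if k = 2 then κ / (2 * μ * (μ + 1)) else 0 with hαdef
  have hα : ∀ k, 0 ≤ α k := by
    intro k
    simp only [hαdef]
    split_ifs
    · rw [← hnμ]; exact ha0
    · exact div_nonneg hm (by positivity)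
    · exact div_nonneg hκ (by positivity)
    · exact le_rfl
  have hpoly : ∀ t : ℝ, ∑ k ∈ range (2 + 1), α k * gegenbauerSum μ k t =
      a 0 + m * t + κ * t ^ 2 := by
    intro t
    simp only [Finset.sum_range_succ, Finset.sum_range_zero, gegenbauerSum_zero, gegenbauerSum_one,
      gegenbauerSum_two, hαdef]
    simp only [if_true, one_ne_zero, if_false, (by norm_num : (2 : ℕ) ≠ 0),
      (by norm_num : (2 : ℕ) ≠ 1)]
    field_simp
    ring
  have hH : ∀ t : ℝ, -1 ≤ t → t < 1 → ∑ k ∈ range (2 + 1), α k * gegenbauerSum μ k t ≤ a t := by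
    intro t ht1 ht2
    rw [hpoly t]
    exact hmin t ht1 ht2
  have key := EnergyLP.energy_ge_inner hnμ hμ 2 α hα a hH C h1
  rw [hN, hpoly 1] at key
  have hα0 : α 0 = a 0 + κ / (2 * μ + 2) := by simp [hαdef]
  rw [hα0] at key
  have hcast : ((2 * n : ℕ) : ℝ) = 2 * (2 * μ + 2) := by push_cast; rw [hnμ]
  rw [hcast] at key
  have hval : (2 * (2 * μ + 2)) ^ 2 * (a 0 + κ / (2 * μ + 2)) -
      2 * (2 * μ + 2) * (a 0 + m * 1 + κ * 1 ^ 2) =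
      2 * (2 * μ + 2) * (2 * (2 * μ + 2 - 1) * a 0 + a (-1)) := by
    rw [hκdef]
    field_simp
    ring
  rw [hnμ]
  linarith [key, hval]

end Summit.Ventures.PackingBounds.Energy
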